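import Summits.BirchSwinnertonDyer.BirchSwinnertonDyer.Theorems.ManinLocalTwoThreeBlindNoDoubling
import HarnessLib

/-!
# E-an-67 `ShimuraLedgerAtFour` AT `N = 4p`: doubling forces a NON-blind rational `2`-torsion point

Summit `BirchSwinnertonDyer`, route `ManinLocalTwoThree` (cell bsd-f2-manin), deciding crux C2 `ManinOddAtFour`
(stmt-BirchSwinnertonDyer-22967); the an planner's row E-an-67 `ShimuraLedgerAtFour` (`ShimuraLedger.lean`): for the optimal
`X₁`/`X₀` pair of a class at `4 ∣ N` with `W₀ = [0, a₂, 0, a₄, a₆]`, `|c₀| = |c₁|`, or `|c₀| = 2|c₁|` AND `W₀` has a NON-blind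
rational `2`-torsion point.  From the machinery of `…BlindNoDoubling` (p634444: half-lattice trichotomy, rational half-period,
Vélu step):

* `index_four_or_hasNonBlind_of_natAbs_eq_two_mul` — at general `4 ∣ N`: `|c₀| = 2|c₁|` ⟹ `Λ₁(f) = 2Λ₀(f)` (index `4`) or
  `HasNonBlindRationalTwoTorsion W₀` (the kernel point `T₀ = (℘(z₀) − a₂/3, 0)` of the étale Shimura `2`-cover is rational,
  and were it blind the Vélu step would contradict the minimality of `W₁`);
* `shimuraLedgerAtFour_of_four_mul[_prime]` — **E-an-67 at `N = 4q` / `4p`** (index `4` impossible there, p632017):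
  `|c₀| = |c₁| ∨ (|c₀| = 2|c₁| ∧ HasNonBlindRationalTwoTorsion W₀)`, unconditionally;
* `shimuraLedgerAtFour_of_noIndexFour` — E-an-67 BY NAME at all `4 ∣ N` from «no index `4` on doubled pairs».

HONEST FRAMING: structure only; C2, Manin's conjecture and BSD are not proved.  No definitions.
-/

set_option autoImplicit false
-- the summit-side namespace `Summit.BirchSwinnertonDyer.BirchSwinnertonDyer.…` is the tree's (summit = sub-problem)
set_option linter.dupNamespace false

noncomputable section

open WeierstrassCurve Literature.NumberTheory.EllipticCurves Literature.NumberTheory.EllipticCurves.ModularForms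
open CongruenceSubgroup
open Summit.BirchSwinnertonDyer.Rank1Residual.ManinAdditive.ShimuraLedger
open Summit.BirchSwinnertonDyer.Rank1Residual.ManinAdditive.CuspidalKummer

namespace Summit.BirchSwinnertonDyer.BirchSwinnertonDyer.Theorems.ManinLocalTwoThree

variable {W₁ W₀ : WeierstrassCurve ℚ} [W₁.IsElliptic] [W₁.IsGloballyMinimal] [W₀.IsElliptic]
  [W₀.IsGloballyMinimal] {N : ℕ} [NeZero N]

/-- **Doubled ⟹ index `4` or a NON-blind rational `2`-torsion point.**  For the optimal `X₁(N)`/`X₀(N)` pair `(D₁, D₀)`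
of a class (`4 ∣ N`, globally minimal, `W₀ = [0, a₂, 0, a₄, a₆]`) with `|c₀| = 2|c₁|`: either `Λ₁(f) = 2Λ₀(f)`, or `W₀` has
a rational `2`-torsion point `(e, 0)` that is NOT Kummer-blind (the kernel of the Shimura `2`-cover `E₀ → E₁`, `z ↦ z`). -/
theorem index_four_or_hasNonBlind_of_natAbs_eq_two_mul (D₁ : Gamma1ParametrizationData W₁ N)
    (D₀ : ModularParametrizationData W₀ N) (hiso : IsIsogenous W₁ W₀) (h₁ : D₁.IsOptimal)
    (h₀ : ∀ z ∈ D₀.L.lattice, ∃ w ∈ periodLattice D₀.f, z = D₀.c * w) (h4 : 2 ^ 2 ∣ N)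
    (ha₁ : W₀.a₁ = 0) (ha₃ : W₀.a₃ = 0) (hdouble : D₀.maninConstant.natAbs = 2 * D₁.maninConstant.natAbs) :
    (∀ z : ℂ, z ∈ periodLatticeGamma1 D₁.f ↔ ∃ w ∈ periodLattice D₀.f, z = 2 * w) ∨
      HasNonBlindRationalTwoTorsion W₀ := by
  classical
  by_cases hnb : HasNonBlindRationalTwoTorsion W₀
  · exact Or.inr hnb
  left
  -- no non-blind rational 2-torsion point ⟹ all rational 2-torsion blind ⟹ the blind theorem applies
  have hblind : AllRationalTwoTorsionBlind W₀ := by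
    rcases allBlind_or_hasNonBlind W₀ with h | h
    · exact h
    · exact absurd h hnb
  exact index_four_of_allBlind_of_natAbs_eq_two_mul D₁ D₀ hiso h₁ h₀ h4 ha₁ ha₃ hblind hdouble

/-- **E-an-67 `ShimuraLedgerAtFour` BY NAME ⟸ «no index `4` on doubled optimal pairs».** -/
theorem shimuraLedgerAtFour_of_noIndexFour
    (h : ∀ (W₁ W₀ : WeierstrassCurve ℚ) [W₁.IsElliptic] [W₁.IsGloballyMinimal] [W₀.IsElliptic]
      [W₀.IsGloballyMinimal] {N : ℕ} [NeZero N] (D₁ : Gamma1ParametrizationData W₁ N)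
      (D₀ : ModularParametrizationData W₀ N), IsIsogenous W₁ W₀ → D₁.IsOptimal →
      (∀ z ∈ D₀.L.lattice, ∃ w ∈ periodLattice D₀.f, z = D₀.c * w) → 2 ^ 2 ∣ N → W₀.a₁ = 0 → W₀.a₃ = 0 →
      D₀.maninConstant.natAbs = 2 * D₁.maninConstant.natAbs →
      ¬ (∀ z : ℂ, z ∈ periodLatticeGamma1 D₁.f ↔ ∃ w ∈ periodLattice D₀.f, z = 2 * w)) :
    ShimuraLedgerAtFour := by
  intro W₁ W₀ _ _ _ _ N _ D₁ D₀ hiso h₁ h₀ h4 ha₁ ha₃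
  rcases natAbs_maninConstant₀_eq_or_eq_two_mul_of_four_dvd_level D₁ D₀ hiso h₁ h₀ h4 with h' | h'
  · exact Or.inl h'
  · refine Or.inr ⟨h', ?_⟩
    rcases index_four_or_hasNonBlind_of_natAbs_eq_two_mul D₁ D₀ hiso h₁ h₀ h4 ha₁ ha₃ h' with hidx | hnb
    · exact absurd hidx (h W₁ W₀ D₁ D₀ hiso h₁ h₀ h4 ha₁ ha₃ h')
    · exact hnb

/-- **E-an-67 at `N = 4q`** (`q` odd, `(ℤ/q)ˣ` cyclic): for the optimal pair of a class with `W₀ = [0, a₂, 0, a₄, a₆]`,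
`|c₀| = |c₁|`, or `|c₀| = 2|c₁|` and `W₀` has a NON-blind rational `2`-torsion point — unconditionally. -/
theorem shimuraLedgerAtFour_of_four_mul {q : ℕ} (hq : Odd q) [IsCyclic (ZMod q)ˣ] [NeZero (4 * q)]
    (D₁ : Gamma1ParametrizationData W₁ (4 * q)) (D₀ : ModularParametrizationData W₀ (4 * q))
    (hiso : IsIsogenous W₁ W₀) (h₁ : D₁.IsOptimal)
    (h₀ : ∀ z ∈ D₀.L.lattice, ∃ w ∈ periodLattice D₀.f, z = D₀.c * w) (ha₁ : W₀.a₁ = 0) (ha₃ : W₀.a₃ = 0) :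
    D₀.maninConstant.natAbs = D₁.maninConstant.natAbs ∨
      (D₀.maninConstant.natAbs = 2 * D₁.maninConstant.natAbs ∧ HasNonBlindRationalTwoTorsion W₀) := by
  have h4 : 2 ^ 2 ∣ 4 * q := ⟨q, by ring⟩
  have hf : D₁.f = D₀.f := D₁.f_eq_of_isIsogenous D₀ hiso
  rcases natAbs_maninConstant₀_eq_or_eq_two_mul_of_four_dvd_level D₁ D₀ hiso h₁ h₀ h4 with h' | h'
  · exact Or.inl h'
  · refine Or.inr ⟨h', ?_⟩
    rcases index_four_or_hasNonBlind_of_natAbs_eq_two_mul D₁ D₀ hiso h₁ h₀ h4 ha₁ ha₃ h' with hidx | hnb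
    · rw [hf] at hidx
      exact absurd hidx (not_periodLatticeGamma1_eq_two_mul_of_four_mul hq D₀ h₀)
    · exact hnb

/-- **E-an-67 at `N = 4p`, `p` an odd prime.** -/
theorem shimuraLedgerAtFour_of_four_mul_prime {p : ℕ} (hp : p.Prime) (hp2 : p ≠ 2) [NeZero (4 * p)]
    (D₁ : Gamma1ParametrizationData W₁ (4 * p)) (D₀ : ModularParametrizationData W₀ (4 * p))
    (hiso : IsIsogenous W₁ W₀) (h₁ : D₁.IsOptimal)
    (h₀ : ∀ z ∈ D₀.L.lattice, ∃ w ∈ periodLattice D₀.f, z = D₀.c * w) (ha₁ : W₀.a₁ = 0) (ha₃ : W₀.a₃ = 0) :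
    D₀.maninConstant.natAbs = D₁.maninConstant.natAbs ∨
      (D₀.maninConstant.natAbs = 2 * D₁.maninConstant.natAbs ∧ HasNonBlindRationalTwoTorsion W₀) := by
  haveI : IsCyclic (ZMod p)ˣ := ZMod.isCyclic_units_prime hp
  exact shimuraLedgerAtFour_of_four_mul (hp.odd_of_ne_two hp2) D₁ D₀ hiso h₁ h₀ ha₁ ha₃

end Summit.BirchSwinnertonDyer.BirchSwinnertonDyer.Theorems.ManinLocalTwoThree

end
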